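import Mathlib
import HarnessLib
import Literature.MathematicalPhysics.KineticTheory.VelocityFlipNoise
import Literature.MathematicalPhysics.KineticTheory.LangevinChainGibbs
import Summits.AtomisticToContinuum.FouriersLaw.Theorems.VanishingNoiseTransferVanishingNoiseBoundFlipWeakToClassical
import Summits.AtomisticToContinuum.FouriersLaw.Theorems.VanishingNoiseTransferVanishingNoiseBoundFlipSmoothMildUpgrade
import Summits.AtomisticToContinuum.FouriersLaw.Theorems.VanishingNoiseTransferNoisyFourierAbelCorrectorExistsAux1
import Summits.AtomisticToContinuum.FouriersLaw.Theorems.VanishingNoiseTransferNoisyFourierAbelCorrectorExistsAux2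

/-!
# Classical Abel correctors of the velocity-flip pinned chain exist (stub `stub_abelCorrectorExists`)

`--supports stmt-AtomisticToContinuum-11977` file closing the registered stub `stub_abelCorrectorExists` (A2) of the
skeleton of line `abel-kapitza-even-corrector`, crux `VanishingNoiseTransfer.NoisyFourier`
(`Summit.AtomisticToContinuum.FouriersLaw.Theses.VanishingNoiseTransfer.NoisyFourier`), part 3 of 3.

CLAIM. For the pinned chain `𝐏 = pinnedChain ω₂ lam β γ` (all parameters `> 0`), `L ≥ 2`, `T > 0`, `ε > 0` and
every `s > 0` there is a CLASSICAL Abel corrector: `u ∈ C²` with `u ∈ L²(μ_T)` and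
`(L_{T,T} + εS) u = s u − J_L` pointwise (`J_L = Σ_i j_i`), i.e. `u = (s − L_ε)⁻¹ J_L`.

Proof (fixed-`L` hypoelliptic regularity, the pipeline of the flip forward fields at `s > 0`):
(a) a measurable `e^{H/(4T)}`-bounded MILD corrector `u = R_{s+Lε}((s+Lε)⁻¹(J + ε Σ_i u ∘ F_i))` exists
(`abel_mildCorrector_exists`, part 1: Banach iteration with the flip-free resolvent kernel);
(b) it is a distributional solution of `(L + εS) u = s u − J` (`abel_mild_weak`, part 2);
(c) the `2^L` flip conjugates solve a square Hörmander system with constant coupling, so `u` is a.e. equal to a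
smooth `v` (`abel_weak_smooth`, part 2 — the shift `−s` sits in the diagonal coupling coefficient);
(d) `v` solves the same distributional equation (the two sides only see `u` a.e.), hence the equation holds
pointwise (`flip_classical_of_weak_smooth`); (e) `|v| ≤ C e^{H/(4T)}` everywhere
(`abs_le_of_ae_eq_of_continuous`), so `v ∈ L²(μ_T)` (`e^{H/(2T)} ∈ L¹(μ_T)`).

* `memLp_two_of_abs_le_exp_quarter` — `|v| ≤ C e^{H/(4T)}`, `v` continuous ⇒ `v ∈ L²(μ_T)`;
* `stub_abelCorrectorExists` — the registered signature.

References: Bernardin–Olla 2011 §5 (the resolvent corrector `(λ − L)⁻¹ j`); Hörmander 1967 Thm 1.1.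
-/

noncomputable section

open MeasureTheory Filter Topology
open scoped BigOperators ContDiff
open Literature.MathematicalPhysics.KineticTheory.HeatConduction
open Summit.AtomisticToContinuum.FouriersLaw.Theorems.SuperadditiveResistance.DeviceLiouville (kin)
open Summit.AtomisticToContinuum.FouriersLaw.Theorems.VanishingNoiseBound (flip_classical_of_weak_smooth
  abs_le_of_ae_eq_of_continuous)

namespace Summit.AtomisticToContinuum.FouriersLaw.Cruxes.NoisyFourier.AbelKapitzaEvenCorrector

section L2

variable {ω₂ lam β γ : ℝ} {N : ℕ}

/-- A continuous `f` with `|f| ≤ C e^{H/(4T)}` is in `L²(μ_T)` for the pinned chain (`ω₂ > 0`, `lam, β ≥ 0`,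
`T > 0`): `f² ≤ C² e^{H/(2T)}` and `e^{ϑH} ∈ L¹(μ_T)` for `ϑ < 1/T`
(`pinnedChain_integrable_exp_mul_hamiltonian_gibbsMeasure`). [folklore] -/
theorem memLp_two_of_abs_le_exp_quarter (hω : 0 < ω₂) (hl : 0 ≤ lam) (hβ : 0 ≤ β) (γ : ℝ) {T : ℝ} (hT : 0 < T)
    {f : PhaseSpace N → ℝ} (hf : Continuous f) {C : ℝ}
    (hb : ∀ y, |f y| ≤ C * Real.exp (1 / (4 * T) * (pinnedChain ω₂ lam β γ).hamiltonian N y)) :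
    MemLp f 2 ((pinnedChain ω₂ lam β γ).gibbsMeasure N T) := by
  -- adapted from `memLp_two_of_abs_le_exp` (…OddSectorIrreversibilityCorrectorTheoryBondSum)
  rw [memLp_two_iff_integrable_sq hf.aestronglyMeasurable]
  have h2ϑ : 2 * (1 / (4 * T)) < 1 / T := by
    rw [show 2 * (1 / (4 * T)) = 1 / (2 * T) by field_simp; ring, one_div_lt_one_div (by positivity) hT]
    linarith
  have h := pinnedChain_integrable_exp_mul_hamiltonian_gibbsMeasure hω hl hβ γ N hT h2ϑ
  refine (h.const_mul (C ^ 2)).mono' (hf.pow 2).aestronglyMeasurable (Eventually.of_forall fun y => ?_)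
  rw [Real.norm_eq_abs, abs_pow]
  calc |f y| ^ 2 ≤ (C * Real.exp (1 / (4 * T) * (pinnedChain ω₂ lam β γ).hamiltonian N y)) ^ 2 :=
        pow_le_pow_left₀ (abs_nonneg _) (hb y) 2
    _ = C ^ 2 * Real.exp (2 * (1 / (4 * T)) * (pinnedChain ω₂ lam β γ).hamiltonian N y) := by
        rw [mul_pow, sq (Real.exp _), ← Real.exp_add]; ring_nf

end L2

/-! ## The registered stub A2 -/

/-- **Stub A2 · classical Abel correctors exist.** For the pinned chain (all parameters `> 0`), `L ≥ 2`,
`T > 0`, `ε > 0`, `s > 0` there is `u ∈ C² ∩ L²(μ_T)` with `(L_{T,T} + εS) u = s u − Σ_i j_i` pointwise: the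
mild corrector (part 1) is a distributional solution (part 2), a.e. equal to a smooth function by the
hypoellipticity of `L + εS − s` (part 2), which solves the equation pointwise
(`flip_classical_of_weak_smooth`) and inherits the bound `C e^{H/(4T)}`, whence `L²(μ_T)`.
[cite: BernardinOlla2011, §5] -/
theorem stub_abelCorrectorExists :
    ∀ (ω₂ lam β γ T ε : ℝ), 0 < ω₂ → 0 < lam → 0 < β → 0 < γ → 0 < T → 0 < ε → ∀ (L : ℕ), 2 ≤ L → ∀ s : ℝ, 0 < s → ∃ u : Literature.MathematicalPhysics.KineticTheory.HeatConduction.PhaseSpace L → ℝ, ContDiff ℝ 2 u ∧ MeasureTheory.MemLp u 2 ((Literature.MathematicalPhysics.KineticTheory.HeatConduction.pinnedChain ω₂ lam β γ).gibbsMeasure L T) ∧ ∀ x, (Literature.MathematicalPhysics.KineticTheory.HeatConduction.pinnedChain ω₂ lam β γ).flipGenerator L T T ε u x = s * u x - ∑ i : Fin L, (Literature.MathematicalPhysics.KineticTheory.HeatConduction.pinnedChain ω₂ lam β γ).bondCurrent L i x := by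
  intro ω₂ lam β γ T ε hω hl hβ hγ hT hε L hL s hs
  have hL1 : 1 < L := by omega
  have hL0 : 0 < L := by omega
  set P := pinnedChain ω₂ lam β γ with hP
  have hU : ContDiff ℝ ∞ P.U := pinnedChain_contDiff_U ω₂ lam β γ
  have hV : ContDiff ℝ ∞ P.V := pinnedChain_contDiff_V ω₂ lam β γ
  have hγ' : P.γ = γ := rfl
  have hγT : 0 ≤ P.γ * T := by rw [hγ']; positivity
  -- (a) the mild corrector
  obtain ⟨u, hum, hub, hmild⟩ := abel_mildCorrector_exists (N := L) hω hl hβ hγ hL1 hT hε hs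
  -- (b) it is a distributional solution of `(L + εS) u = s u − J`
  have hweak := abel_mild_weak hω hl hβ hγ hL hT hε hs hum hub hmild
  -- (c) a smooth representative
  obtain ⟨v, hvs, hae⟩ := abel_weak_smooth hβ hγ hL hT hT ε s hum
    (hub.imp fun C hC => ⟨1 / (4 * T), hC⟩) hweak
  -- (d) `v` solves the distributional equation, hence the classical one
  have hJc : Continuous fun x : PhaseSpace L => ∑ i : Fin L, P.bondCurrent L i x :=
    continuous_finsetSum _ fun i _ => pinnedChain_continuous_bondCurrent ω₂ lam β γ L i
  have hFc : Continuous fun x : PhaseSpace L => s * v x - ∑ i : Fin L, P.bondCurrent L i x :=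
    (continuous_const.mul hvs.continuous).sub hJc
  have hweakv : ∀ φ : PhaseSpace L → ℝ, ContDiff ℝ ∞ φ → HasCompactSupport φ →
      ∫ x, v x * (-(P.generator L T T φ x) +
          2 * P.γ * (T * partialP (⟨0, hL0⟩ : Fin L) (partialP (⟨0, hL0⟩ : Fin L) φ) x +
            T * partialP (⟨L - 1, Nat.sub_lt hL0 one_pos⟩ : Fin L)
              (partialP (⟨L - 1, Nat.sub_lt hL0 one_pos⟩ : Fin L) φ) x) +
          2 * P.γ * φ x + ε * flipNoise L φ x) =
        ∫ x, (s * v x - ∑ i : Fin L, P.bondCurrent L i x) * φ x := by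
    intro φ hφ hφc
    have h1 := hweak φ hφ hφc
    rw [hγ']
    have e1 : (fun x => v x * (-(P.generator L T T φ x) +
          2 * γ * (T * partialP (⟨0, hL0⟩ : Fin L) (partialP (⟨0, hL0⟩ : Fin L) φ) x +
            T * partialP (⟨L - 1, Nat.sub_lt hL0 one_pos⟩ : Fin L)
              (partialP (⟨L - 1, Nat.sub_lt hL0 one_pos⟩ : Fin L) φ) x) +
          2 * γ * φ x + ε * flipNoise L φ x)) =ᵐ[volume]
        fun x => u x * (-(P.generator L T T φ x) +
          2 * γ * (T * partialP (⟨0, hL0⟩ : Fin L) (partialP (⟨0, hL0⟩ : Fin L) φ) x +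
            T * partialP (⟨L - 1, Nat.sub_lt hL0 one_pos⟩ : Fin L)
              (partialP (⟨L - 1, Nat.sub_lt hL0 one_pos⟩ : Fin L) φ) x) +
          2 * γ * φ x + ε * flipNoise L φ x) := by
      filter_upwards [hae] with x hx
      rw [hx]
    have e2 : (fun x => (s * v x - ∑ i : Fin L, P.bondCurrent L i x) * φ x) =ᵐ[volume]
        fun x => (s * u x - ∑ i : Fin L, P.bondCurrent L i x) * φ x := by
      filter_upwards [hae] with x hx
      rw [hx]
    rw [integral_congr_ae e1, integral_congr_ae e2]
    exact h1
  have hclass := flip_classical_of_weak_smooth P hU hV hL0 hγT hγT ε (u := v)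
    (F := fun x => s * v x - ∑ i : Fin L, P.bondCurrent L i x) hvs hFc hweakv
  -- (e) the exponential bound everywhere and `L²(μ_T)`
  obtain ⟨C, hC⟩ := hub
  have hBc : Continuous fun z : PhaseSpace L => C * Real.exp (1 / (4 * T) * P.hamiltonian L z) :=
    continuous_const.mul (Real.continuous_exp.comp
      (continuous_const.mul (pinnedChain_continuous_hamiltonian ω₂ lam β γ L)))
  have hvb : ∀ z, |v z| ≤ C * Real.exp (1 / (4 * T) * P.hamiltonian L z) :=
    abs_le_of_ae_eq_of_continuous hvs.continuous hBc hC hae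
  have hmem : MemLp v 2 (P.gibbsMeasure L T) := memLp_two_of_abs_le_exp_quarter hω hl.le hβ.le γ hT hvs.continuous hvb
  refine ⟨v, hvs.of_le (by norm_cast), hmem, fun x => ?_⟩
  rw [OscillatorChain.flipGenerator_eq_add_flipNoise, hclass x]

end Summit.AtomisticToContinuum.FouriersLaw.Cruxes.NoisyFourier.AbelKapitzaEvenCorrector

end
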